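import Mathlib

/-!
# T5CofiniteIntersection — the intersection bookkeeping of N5 §N5.10.2 / route-3 §G(b)
(pub-hodge-repro2, seat p2, kernel annex; support for the N5 owner, cited or ignored)

Prose (route/T5-route-2.md v0.2 §N5.10.2, answering ref-4 T5-R4-N5-1): «for an intersection
argument over ONE twist family `{ξ_i ν̃ : ν̃ ∈ Ξ}` one needs, per family, either a JOINT statement
(all four central values ≠ 0 for infinitely many `ν̃`) or cofinite-type statements («all but
finitely many `ν̃`») for at least THREE of the four characters — then the fourth may be
«infinitely many» — because «infinitely many» ∩ «infinitely many» is not controlled»; and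
route/T5-route-3.md v0.4 §G(b): «Proposition G gives cofinite-type statements for 4 of 4 (one per
character, same family `Ξ_𝔭`), so the intersection is cofinite».

Formalised for subsets `A i` of an arbitrary type `Ξ` (the family): cofinite ∩ cofinite is
cofinite (any finite number of them); three cofinite sets and one infinite set have an infinite
intersection; two infinite sets can be disjoint (evens and odds in `ℕ`) — so «infinitely many» ×2
gives nothing by itself.
-/

namespace Summit.Ventures.HodgeRepro2.T5CofiniteIntersection

variable {Ξ : Type*}

/-- An infinite set meets a cofinite set in an infinite set. -/
theorem infinite_inter_of_finite_compl {A B : Set Ξ} (hA : A.Infinite) (hB : Bᶜ.Finite) :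
    (A ∩ B).Infinite := by
  have : A ∩ B = A \ Bᶜ := by
    ext x
    simp
  rw [this]
  exact hA.sdiff hB

/-- The intersection of finitely many cofinite sets is cofinite. -/
theorem finite_compl_iInter {ι : Type*} [Finite ι] (A : ι → Set Ξ)
    (h : ∀ i, (A i)ᶜ.Finite) : (⋂ i, A i)ᶜ.Finite := by
  rw [Set.compl_iInter]
  exact Set.finite_iUnion h

/-- route-3 §G(b): four cofinite-type statements (one per character) intersect in a cofinite set;
in particular, if the family is infinite, in an infinite set. -/
theorem finite_compl_inter_four {A₁ A₂ A₃ A₄ : Set Ξ}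
    (h₁ : A₁ᶜ.Finite) (h₂ : A₂ᶜ.Finite) (h₃ : A₃ᶜ.Finite) (h₄ : A₄ᶜ.Finite) :
    (A₁ ∩ A₂ ∩ A₃ ∩ A₄)ᶜ.Finite := by
  simp only [Set.compl_inter]
  exact ((h₁.union h₂).union h₃).union h₄

/-- N5.10.2: THREE cofinite-type statements and ONE «infinitely many» statement intersect in an
infinite set (so the fourth character may be the «infinitely many» one). -/
theorem infinite_inter_of_three_cofinite {A₁ A₂ A₃ A₄ : Set Ξ}
    (h₁ : A₁ᶜ.Finite) (h₂ : A₂ᶜ.Finite) (h₃ : A₃ᶜ.Finite) (h₄ : A₄.Infinite) :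
    (A₄ ∩ A₁ ∩ A₂ ∩ A₃).Infinite :=
  infinite_inter_of_finite_compl
    (infinite_inter_of_finite_compl (infinite_inter_of_finite_compl h₄ h₁) h₂) h₃

/-- N5.10.2, the negative half: «infinitely many» ∩ «infinitely many» is not controlled — two
infinite subsets of an infinite family can be disjoint (the even and the odd numbers). -/
theorem exists_infinite_infinite_disjoint :
    ∃ A B : Set ℕ, A.Infinite ∧ B.Infinite ∧ A ∩ B = ∅ := by
  refine ⟨{n | Even n}, {n | Odd n}, ?_, ?_, ?_⟩
  · exact Set.infinite_of_not_bddAbove fun ⟨m, hm⟩ =>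
      absurd (hm (show Even (2 * (m + 1)) from even_two_mul _)) (by omega)
  · exact Set.infinite_of_not_bddAbove fun ⟨m, hm⟩ =>
      absurd (hm (show Odd (2 * m + 1) from odd_two_mul_add_one _)) (by omega)
  · ext n
    simp only [Set.mem_inter_iff, Set.mem_setOf_eq, Set.mem_empty_iff_false, iff_false, not_and]
    exact fun he ho => (Nat.not_even_iff_odd.mpr ho) he

end Summit.Ventures.HodgeRepro2.T5CofiniteIntersection
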